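import Summits.QuantumFields.YangMills.Theorems.BalabanUVNodesN12NearFlatFederbushFibreTwisted
import Summits.QuantumFields.YangMills.Theorems.BalabanUVNodesN12NearFlatDelta2Letter
import Summits.QuantumFields.YangMills.Theorems.BalabanUVNodesN12GuardedLinAvgRightInverseBj
import Summits.QuantumFields.YangMills.Theorems.BalabanUVNodesN12FlatRightInverseLetterFloor
import Literature.MathematicalPhysics.QuantumFieldTheory.Balaban1983to89.Node00.MultiScaleFibreChartCurvatureUniform
import Literature.MathematicalPhysics.QuantumFieldTheory.Balaban1983to89.B16Ineq17NearFlatWilsonLettersLocal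
import Summits.QuantumFields.YangMills.Theorems.BalabanUVNodesN12NearFlatChartLetterBookkeeping

/-!
# DAG node N12 [B15] — THE CHART LETTER (χ) OF THE NEAR-FLAT PACKAGE (N), ASSEMBLED BY NAME: the chart-side tail `∃ Ψ₂ λ p q L_f R_f, …` of the lane owner's assembled endpoint
# (J-C ∕ J-C-coer, `B15Prop1EndpointNearFlatLetters` ∕ `B15Prop1CoerciveAtNormalisedDatum` §3 `hNFn`) at ONE instance and ONE base field, in the exact shape of the letter `hχ` of
# dag-n12-w5's junction `B15Prop1NearFlatPackageFromLetters.nearFlatPackage_of_letters` (p625120), produced from this lineage's landed letters (regularity and Lagrange form of the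
# chart of record, (μ), (δ₂), the twisted Federbush `hm`) and dag-n10-w1's flat right inverse — with ONE observation doing the work: (χ)'s two near-flatness letters make `U₀`
# GLOBALLY near-flat

[Balaban1989LargeFieldII] = «[LF-II]», p. 357 («we apply the construction of Sect. F [15] to the configuration U₀, and doing a proper gauge transformation we represent it in the form
U₀ = exp iξA₀ …»), (1.7)–(1.9) p. 358, (1.12)–(1.13) p. 359; [Balaban1985Variational] = «[15]», Sect. C (44)–(48) p. 285, (81)–(83) p. 290, (172) p. 305; [Balaban1988Convergent] = «[III]»,
(2.2) p. 255 («Γ₀ = Ωᶜ₁»), (2.10)–(2.13) pp. 256–257; [Balaban1985Averaging], Prop. 3 (121)–(125) p. 36; [Balaban1987RG1], (0.4) p. 253.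

Cell `pub-ymgap`, HUMAN RULINGS D-0062 ∕ D-0149, width seat `pub-ymgap-dag-n12-w4` generation 4 (WIDTH SEAT 4 of 4 on N12; INBOX CLAIM-1 ∕ INTENT-1 of 2026-08-28 l.36204).  Key K1⁹
`stmt-QuantumFields-27364` (KEY MAP v2), `--kind proof --supports stmt-QuantumFields-27364 --as helper`; count-neutral.  NEW leaf; CONSUMED BY NAME, nothing modified: this seat's
`…N12NearFlatFederbushFibreTwisted.exists_m_hm_twisted_window_of_isMinimizer_family` (p611770), `…N12NearFlatDelta2Letter.exists_delta2_letter_Bj` ∕ `exists_guard_of_nearFlat` ∕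
`exists_rightInverse_fun_of_flat_of_delta2` (p618836 ∕ p620953), `Node00.MultiScaleFibreChartCurvatureUniform.exists_uniform_lam_mu_msChart` ∕ `exists_uniform_chartCurvature_sq_bound`
(p615328), `Node00.MultiScaleFibreChartLagrange` regularity binders (p610492), `B16Ineq17NearFlatWilsonLettersLocal.letter_j_wilson_local` (p623648); dag-n10-w1's
`…N12GuardedLinAvgRightInverseBj.exists_rightInverse_fderiv_msChart_Bj_one` (the flat right inverse at `𝐁_k(Z)`) and `…N12GuardedChartDerivIterLin.exists_norm_iterM_sub_one_le`;
dag-n12-w3's `B16Ineq19FlatSliceChart.exists_lieSU2Coord`; dag-n12-w2's `B16Ineq19NearFlatSliceNorms`.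

THE OBSERVATION (§1).  The letter (χ) of p625120 hands its producer a (2.12)-minimiser `U₀` with TWO near-flatness letters: C1 — `δc`-near `1` on the four bonds of every plaquette having a
bond sourced in `Ω₁(Z) = maxDomT ν.M₁ Z 1` (the Wilson side's currency) — and Cin — `δin`-near `1` on `inputs 𝐁_k(Z)` (the chart side's).  By [III] (2.2) the finest member of the
determining set of record is `Γ₀ = Ω₁ᶜ` (`B14.Eq213DetSet.Bj_zero`): EVERY fine bond not sourced in `Ω₁` meets `Γ₀`, hence lies in `bondsOf (𝐁_k(Z) 0) ⊆ inputs 𝐁_k(Z)` (`feeds_zero`);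
every bond sourced in `Ω₁` is the `⟨p.src, p.μ⟩`- or `⟨p.src, p.ν⟩`-bond of a plaquette of C1's kind (`2 ≤ d`).  So **`‖↑(U₀ b) − 1‖ ≤ max δc δin` for EVERY bond** — (χ)'s `U₀` is
GLOBALLY near-flat in dag-n10-w1's sup currency, and the GLOBAL editions of every chart-side letter apply verbatim: module D's plaquette guard through `exists_guard_of_nearFlat`,
(δ₂) through `exists_delta2_letter_Bj`, the regularity binders and `SmallBelow` through `exists_uniform_chartCurvature_sq_bound`, (μ) through `exists_uniform_lam_mu_msChart` fed
with the GLOBAL current letter `j = 8(d−1)·max δc δin·√#bonds` (`letter_j_wilson_local` at `B₀ = univ`) and the Neumann right inverse of `exists_rightInverse_fun_of_flat_of_delta2`,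
the twisted Federbush clause through p611770 with the twist size read off `exists_norm_iterM_sub_one_le`.  The (r1) ∕ `_loc` localisation is a Wilson-side matter of J-C §5, not of (χ).

CONTENTS (namespace `Summit.QuantumFields.YangMills.BalabanUVNodes.N12NearFlatChartLetter`; file 2 of 2 — file 1 `…N12NearFlatChartLetterBookkeeping` holds §1 THE OBSERVATION
`norm_sub_one_le_of_plaqNear_of_inputs` and §2 the seminorm `p := bond-ℓ²(HS)` letters; theorems only — no `def`, no `instance`, no `sorry`).
* §3 ★★★ `chartLetter_of_letters` — for ONE instance (`ν Kt`, `0 < k ≤ m + K`, `Z Λ T lo hi`) under DISPLAYED instance-geometry letters only (`2 ≤ d`; `2 ≤ ν.M₁`; the torus divisibility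
  `side L ν.M₁ k ∣ sitesPerDir 0` of dag-n10-w1's H3; the box `[lo − 2, hi + 4]` fits the torus and p611770's window placement `hΩw` of it in `Ω_k(Z)^{(k)}`): ONE package of per-height ∕
  instance EXISTENCE constants `ρ⋆ > 0`, `Cμ Cρ C₂ Cτ ≥ 0` such that for every extension map `ext`, base field `V_k`, (J0′)-radius `R > 0` and bound `𝓐₀ ≥ 0`, and all `δc, δin ≥ 0` with
  `0 < max δc δin ≤ ρ⋆`, THE LETTER (χ) HOLDS VERBATIM with `γ₀ := (L^d)^k∕(L²L²)^k`, `μc := Cμ·max δc δin`, `ρc := Cρ`, `δ₂c := C₂·max δc δin`,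
  `Kc := 12𝓐₀∕R·√#{b | b.src ∈ Ω₁(Z)}`, `τc := γ₀·16(d+1)·(Cτ·max δc δin)` (`p := bond-ℓ²(HS)`, `q := ‖·‖` (sup), `L_f := DΦ♭(0)` the flat chart of record, `R_f :=` dag-n10-w1's flat `H`).
TYPING NOTE.  The proof is one composition by name and elaborates in ≈ 15 s of wall time, but its cumulative unification cost exceeds the default heartbeat budget (the literal-`Fin 2`
objects of the record meet `N`-generic NODE 00 lemmas; every junction re-checks large instance-laden types), hence `set_option maxHeartbeats 400000 in` on the one theorem — the
tree's standing practice for knits of this size (no other option is touched).  Pauli coordinates of `𝔰𝔲(2)` (dag-n12-w3's `exists_lieSU2Coord`) are eliminated in term mode at the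
point of use.

HONEST FRAMING ∕ LOCATED.  Composition by name; EVERY constant is a per-height ∕ per-instance EXISTENCE constant (smoothness ∕ compactness ∕ finite-dimensionality on a finite 𝕋⁴ — module D's
`C`, the chart curvature `M₂`, the operator norm of the flat right inverse, `K_τ`), NOT print's volume-uniform ones; in particular `ρc` is read in `(p, q) = (ℓ²(HS), sup)` and so carries
dag-n10-w1's LOCATED-RHO floor (`…N12FlatRightInverseLetterFloor`, bus l.35946) until the weighted `q_η` letters of the lane's exit (b) land — the skeleton here is currency-agnostic and a
v1.1 re-reads `ρc` ∕ `δ₂c` by name; the numerics `hsm` stay the knit's displayed letter (only `μc`, `δ₂c`, `τc` scale with `max δc δin`).  Nothing of Bałaban's (1.7) ∕ (1.12) ∕ Prop. 1 is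
asserted; count-neutral helper; N12 NOT discharged; K1⁹ NOT closed; counts unmoved (5∕27); one finite 𝕋⁴ programme at fixed ε — R4 closes the conditional finite-𝕋⁴ rung `BalabanLadder.UV`
only; NOT continuum ∕ ℝ⁴ ∕ OS ∕ mass gap ∕ Clay.
-/

noncomputable section

open scoped BigOperators Matrix.Norms.L2Operator Topology NNReal
open Filter Finset Metric

namespace Summit.QuantumFields.YangMills.BalabanUVNodes.N12NearFlatChartLetter

open Literature.MathematicalPhysics.QuantumFieldTheory.Balaban1983to89
open Literature.MathematicalPhysics.QuantumLattice (quatMatrix)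
open T4Continuum (T4Family)
open T4HaarSU2ExpChart (imQuat)
open T4AdjointCovarianceUnitary (lieSU)
open T4CubeChartGnomonic (SU2)
open B15DeterminingSets GaugeField
open B14.Eq213DetSet (Bj Bj_of_gt Bj_zero maxDomT)
open B14.Eq213MaximalDomains (side)
open B14.Eq216Concrete (inputs mem_inputs feeds_zero)
open B15Prop1SliceCoordinates (GaugeSlice ιA)
open B15Prop1ChartCalculusSU2 (E3)
open B15Prop1ChartSU2 (su2Chart)
open B16Sect1Backgrounds (expMul)
open T4AxialGaugeSmallField (castSite)
open B6TreeGaugePoincare (curl)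
open B16Eq18Proof (box)
open BlockAveragingEMLLinearised (linAvg)
open ExpMeanLog (expMeanLogSU deltaSU)
open Literature.MathematicalPhysics.QuantumFieldTheory.BalabanImbrieJaffe1984to88.BIJ85Eq453GaugeField (qsstarGIter0)
open Node00
open Summit.QuantumFields.YangMills.Theorems.BlockAvgCorrector (stokesConst)
open B16Ineq19FlatSliceChart (exists_lieSU2Coord)
open B16Ineq19NearFlatSliceNorms (opNorm_coe_le_norm_lieSU sum_opNorm_coe_sq_le_sum_norm_sq)
open B16Ineq17NearFlatWilsonLettersLocal (letter_j_wilson_local)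
open Summit.QuantumFields.YangMills.BalabanUVNodes.N12NearFlatFederbushFibreTwisted (exists_m_hm_twisted_window_of_isMinimizer_family)
open Summit.QuantumFields.YangMills.BalabanUVNodes.N12NearFlatDelta2Letter (exists_delta2_letter_Bj exists_guard_of_nearFlat exists_rightInverse_fun_of_flat_of_delta2)
open Summit.QuantumFields.YangMills.BalabanUVNodes.N12GuardedLinAvgRightInverseBj (exists_rightInverse_fderiv_msChart_Bj_one)
open Summit.QuantumFields.YangMills.BalabanUVNodes.N12GuardedChartDerivIterLin (exists_norm_iterM_sub_one_le)
open Summit.QuantumFields.YangMills.BalabanUVNodes.N12FlatRightInverseLetterFloor (norm_sq_lieSU_le_card_mul_opNorm_sq)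

variable {F : T4Family}

/-! ## §3  ★★★ The chart letter (χ), assembled -/

section Main

set_option maxHeartbeats 400000 in
/-- ★★★ **THE CHART LETTER (χ) OF THE NEAR-FLAT PACKAGE (N), ASSEMBLED BY NAME.**  For ONE Prop-1 instance at print's (1.74) object — averaging `Node00.avOfRecord F 2 Kt`, class
`regMSCoPOfRecord F 2 ν Kt k (maxDomT ν.M₁ Z)`, determining set `𝐁_k(Z) = Bj ν.M₁ Z k` (`0 < k ≤ m + K`), slice `GaugeSlice (pts k Λ) T E3`, box `[lo, hi]` — under the DISPLAYED
instance-geometry letters `2 ≤ d`, `2 ≤ M₁`, the torus divisibility of dag-n10-w1's H3, «the box `[lo − 2, hi + 4]` fits the torus» and p611770's window placement `hΩw` of that box in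
`Ω_k(Z)^{(k)}`, there is ONE package of EXISTENCE constants `ρ⋆ > 0`, `Cμ Cρ C₂ Cτ ≥ 0` (per height ∕ instance; NOT print's volume-uniform ones) such that for every extension map `ext`,
base field `V_k`, (J0′)-radius `R > 0` and bound `𝓐₀ ≥ 0`, and all `δc δin ≥ 0` with `0 < max δc δin ≤ ρ⋆`, the letter (χ) of `B15Prop1NearFlatPackageFromLetters.nearFlatPackage_of_letters`
HOLDS — text verbatim — with `γ₀ := (L^d)^k∕(L²L²)^k`, `μc := Cμ·max δc δin`, `ρc := Cρ`, `δ₂c := C₂·max δc δin`, `Kc := 12𝓐₀∕R·√#{b | b.src ∈ Ω₁(Z)}`, `τc := γ₀·16(d+1)·(Cτ·max δc δin)`.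
Inside: §1's observation (global near-flatness `max δc δin`), `p := bond-ℓ²(HS)` (§2), `q := ‖·‖`, `L_f := DΦ♭(0)` (the flat chart of record at `𝐁_k(Z)`), `R_f :=` dag-n10-w1's flat right
inverse `H` (`exists_rightInverse_fderiv_msChart_Bj_one`); `hΨ₂`∕`hΨd` by `Node00.hasFDerivAt_fderiv_msChart`∕`eventually_differentiableAt_msChart` under the `SmallBelow` guard of
`exists_uniform_chartCurvature_sq_bound`; `hlam` + (μ) by `exists_uniform_lam_mu_msChart` fed with the global current letter (`letter_j_wilson_local` at `B₀ = univ`) and the Neumann right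
inverse of `exists_rightInverse_fun_of_flat_of_delta2` over module D's (δ₂) (`exists_delta2_letter_Bj`, guard by `exists_guard_of_nearFlat`); (δ₂) itself; (K) by §2 from (χ)'s per-bond
velocity bound and support letter; the Federbush clause through the twist by p611770 with `τ := Cτ·max δc δin`, the datum's top constrained averages being `Ū^k(U₀)` on the fibre and
`‖Ū^k(U₀) − 1‖ ≤ K_τ‖↑U₀ − 1‖` (`exists_norm_iterM_sub_one_le`).
[cite: Balaban1989LargeFieldII, p.357, (1.7)–(1.9) p.358, (1.12)–(1.13) p.359; Balaban1985Variational, Sect. C (44)–(48) p.285, (81)–(83) p.290, (172) p.305; Balaban1988Convergent, (2.2) p.255, (2.10)–(2.13) pp.256–257; Balaban1985Averaging, Prop. 3 (121)–(125) p.36] -/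
theorem chartLetter_of_letters (ν : Node00.Stage7Numerics) (Kt : ℕ) (h0 : 0 < (F.P Kt).d) (h2 : 2 ≤ (F.P Kt).d)
    {k : ℕ} (hk0 : 0 < k) (hk : k ≤ (F.P Kt).m + (F.P Kt).K)
    (Z Λ : Set (Site (F.P Kt) 0)) (T : Finset (PBond (F.P Kt) k)) (lo hi : Fin (F.P Kt).d → ℤ)
    -- instance geometry letters (displayed)
    (hM2 : 2 ≤ ν.M₁) (hdiv : side (F.P Kt).L ν.M₁ k ∣ (F.P Kt).sitesPerDir 0)
    (hbox : ∀ κ, (((hi κ - lo κ + 1).toNat + 3 : ℕ) : ℤ) ≤ (F.P Kt).sitesPerDir k)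
    (hΩw : ∀ (ν' : Fin (F.P Kt).d), ∀ z ∈ box (fun κ => (hi κ - lo κ + 1).toNat + 3) (fun κ => lo κ - 2),
      (castSite z : Site (F.P Kt) k) ∈ pts k (maxDomT ν.M₁ Z k) ∧ (castSite z : Site (F.P Kt) k).shift ⟨0, h0⟩ ∈ pts k (maxDomT ν.M₁ Z k) ∧
        (castSite z : Site (F.P Kt) k).shift ν' ∈ pts k (maxDomT ν.M₁ Z k)) :
    ∃ ρs Cμ Cρ C₂ Cτ : ℝ, 0 < ρs ∧ 0 ≤ Cμ ∧ 0 ≤ Cρ ∧ 0 ≤ C₂ ∧ 0 ≤ Cτ ∧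
      ∀ (ext : GaugeField (F.P Kt) k SU2 → GaugeField (F.P Kt) k SU2) (Vk : GaugeField (F.P Kt) k SU2) {R 𝓐₀ : ℝ}, 0 < R → 0 ≤ 𝓐₀ →
      ∀ {δc δin : ℝ}, 0 ≤ δc → 0 ≤ δin → 0 < max δc δin → max δc δin ≤ ρs →
      ∀ (U₀ : GaugeField (F.P Kt) 0 SU2) (Xf : GaugeSlice (pts k Λ) T E3 → PBond (F.P Kt) 0 → lieSU (Fin 2)),
      IsMinimizer (Node00.avOfRecord F 2 Kt) (Node00.regMSCoPOfRecord F 2 ν Kt k (maxDomT ν.M₁ Z)) (Bj ν.M₁ Z k)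
        (avgFamily (Node00.avOfRecord F 2 Kt) (qsstarGIter0 k (ext Vk))) U₀ →
      (∀ p : Plaq (F.P Kt) 0, ((⟨p.src, p.μ⟩ : PBond (F.P Kt) 0) ∈ {b : PBond (F.P Kt) 0 | b.src ∈ maxDomT ν.M₁ Z 1} ∨
          (⟨p.src.shift p.μ, p.ν⟩ : PBond (F.P Kt) 0) ∈ {b : PBond (F.P Kt) 0 | b.src ∈ maxDomT ν.M₁ Z 1} ∨
          (⟨p.src.shift p.ν, p.μ⟩ : PBond (F.P Kt) 0) ∈ {b : PBond (F.P Kt) 0 | b.src ∈ maxDomT ν.M₁ Z 1} ∨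
          (⟨p.src, p.ν⟩ : PBond (F.P Kt) 0) ∈ {b : PBond (F.P Kt) 0 | b.src ∈ maxDomT ν.M₁ Z 1}) →
        ‖((U₀ ⟨p.src, p.μ⟩ : SU2) : Matrix (Fin 2) (Fin 2) ℂ) - 1‖ ≤ δc ∧ ‖((U₀ ⟨p.src.shift p.μ, p.ν⟩ : SU2) : Matrix (Fin 2) (Fin 2) ℂ) - 1‖ ≤ δc ∧
          ‖((U₀ ⟨p.src.shift p.ν, p.μ⟩ : SU2) : Matrix (Fin 2) (Fin 2) ℂ) - 1‖ ≤ δc ∧ ‖((U₀ ⟨p.src, p.ν⟩ : SU2) : Matrix (Fin 2) (Fin 2) ℂ) - 1‖ ≤ δc) →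
      (∀ b ∈ inputs (Bj ν.M₁ Z k), ‖((U₀ b : SU2) : Matrix (Fin 2) (Fin 2) ℂ) - 1‖ ≤ δin) →
      Xf 0 = 0 → ContDiffAt ℝ 2 Xf 0 →
      (∀ᶠ Y in 𝓝 (0 : GaugeSlice (pts k Λ) T E3),
        IsMinimizer (Node00.avOfRecord F 2 Kt) (Node00.regMSCoPOfRecord F 2 ν Kt k (maxDomT ν.M₁ Z)) (Bj ν.M₁ Z k)
          (avgFamily (Node00.avOfRecord F 2 Kt) (qsstarGIter0 k (expMul su2Chart (ιA (pts k Λ) T Y) (ext Vk)))) (expChart U₀ (Xf Y))) →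
      (∀ (X : GaugeSlice (pts k Λ) T E3) (b : PBond (F.P Kt) 0),
        ‖((fderiv ℝ Xf 0 X b : lieSU (Fin 2)) : Matrix (Fin 2) (Fin 2) ℂ)‖ ≤ 8 * 𝓐₀ / R * ‖X‖ ∧ ‖fderiv ℝ Xf 0 X b‖ ≤ 12 * 𝓐₀ / R * ‖X‖) →
      (∀ (X : GaugeSlice (pts k Λ) T E3) (b : PBond (F.P Kt) 0), b.src ∉ maxDomT ν.M₁ Z 1 → fderiv ℝ Xf 0 X b = 0) →
      ∃ (Ψ₂ : (PBond (F.P Kt) 0 → lieSU (Fin 2)) →L[ℝ] (PBond (F.P Kt) 0 → lieSU (Fin 2)) →L[ℝ] (Fin (constrCard (Bj ν.M₁ Z k) k) → lieSU (Fin 2)))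
        (lam : (Fin (constrCard (Bj ν.M₁ Z k) k) → lieSU (Fin 2)) →L[ℝ] ℝ)
        (p : Seminorm ℝ (PBond (F.P Kt) 0 → lieSU (Fin 2))) (q : (Fin (constrCard (Bj ν.M₁ Z k) k) → lieSU (Fin 2)) → ℝ)
        (Lf : (PBond (F.P Kt) 0 → lieSU (Fin 2)) →L[ℝ] (Fin (constrCard (Bj ν.M₁ Z k) k) → lieSU (Fin 2)))
        (Rf : (Fin (constrCard (Bj ν.M₁ Z k) k) → lieSU (Fin 2)) → PBond (F.P Kt) 0 → lieSU (Fin 2)),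
        HasFDerivAt (fun Y => fderiv ℝ (msChart F 2 Kt k (Bj ν.M₁ Z k) (avgFamily (Node00.avOfRecord F 2 Kt) (qsstarGIter0 k (ext Vk))) U₀) Y) Ψ₂ 0 ∧
        (∀ᶠ Y in 𝓝 (0 : PBond (F.P Kt) 0 → lieSU (Fin 2)),
          DifferentiableAt ℝ (msChart F 2 Kt k (Bj ν.M₁ Z k) (avgFamily (Node00.avOfRecord F 2 Kt) (qsstarGIter0 k (ext Vk))) U₀) Y) ∧
        fderiv ℝ (fun Y : PBond (F.P Kt) 0 → lieSU (Fin 2) => wilsonAction4 (expChart U₀ Y)) 0 =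
          lam.comp (fderiv ℝ (msChart F 2 Kt k (Bj ν.M₁ Z k) (avgFamily (Node00.avOfRecord F 2 Kt) (qsstarGIter0 k (ext Vk))) U₀) 0) ∧
        (∀ Y : PBond (F.P Kt) 0 → lieSU (Fin 2), ∑ b, ‖(Y b : Matrix (Fin 2) (Fin 2) ℂ)‖ ^ 2 ≤ p Y ^ 2) ∧
        (∀ v, Lf (Rf v) = v) ∧ (∀ v, p (Rf v) ≤ Cρ * q v) ∧
        ∀ X : GaugeSlice (pts k Λ) T E3,
          q (fderiv ℝ (msChart F 2 Kt k (Bj ν.M₁ Z k) (avgFamily (Node00.avOfRecord F 2 Kt) (qsstarGIter0 k (ext Vk))) U₀) 0 (fderiv ℝ Xf 0 X)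
              - Lf (fderiv ℝ Xf 0 X)) ≤ (C₂ * max δc δin) * p (fderiv ℝ Xf 0 X) ∧
          lam (Ψ₂ (fderiv ℝ Xf 0 X) (fderiv ℝ Xf 0 X)) ≤ (Cμ * max δc δin) * p (fderiv ℝ Xf 0 X) ^ 2 ∧
          p (fderiv ℝ Xf 0 X) ≤ (12 * 𝓐₀ / R * Real.sqrt (Nat.card {b : PBond (F.P Kt) 0 // b.src ∈ maxDomT ν.M₁ Z 1})) * ‖X‖ ∧
          ∃ m : ℝ, (∀ w', Lf w' = fderiv ℝ (msChart F 2 Kt k (Bj ν.M₁ Z k) (avgFamily (Node00.avOfRecord F 2 Kt) (qsstarGIter0 k (ext Vk))) U₀) 0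
                (fderiv ℝ Xf 0 X) →
              m ≤ fderiv ℝ (fun Y => fderiv ℝ (fun Y : PBond (F.P Kt) 0 → lieSU (Fin 2) => wilsonAction4 (expChart (1 : GaugeField (F.P Kt) 0 SU2) Y)) Y) 0 w' w') ∧
            (((F.P Kt).L : ℝ) ^ (F.P Kt).d) ^ k / ((((F.P Kt).L : ℝ)) ^ 2 * ((F.P Kt).L : ℝ) ^ 2) ^ k *
                (∑ z ∈ box (fun κ => (hi κ - lo κ + 1).toNat + 3) (fun κ => lo κ - 2), ∑ μ : Fin (F.P Kt).d, ∑ a : Fin 3,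
                  curl (fun b => ιA (pts k Λ) T X (⟨castSite b.1, b.2⟩ : PBond (F.P Kt) k) a) z ⟨0, h0⟩ μ ^ 2)
              - ((((F.P Kt).L : ℝ) ^ (F.P Kt).d) ^ k / ((((F.P Kt).L : ℝ)) ^ 2 * ((F.P Kt).L : ℝ) ^ 2) ^ k
                  * (16 * (((F.P Kt).d : ℝ) + 1) * (Cτ * max δc δin))) * ‖X‖ ^ 2 ≤ m := by
  -- ### the auxiliary `linAvg` iterate of the (δ₂) module
  let Q : (i : ℕ) → (PBond (F.P Kt) 0 → Matrix (Fin 2) (Fin 2) ℂ) → PBond (F.P Kt) i → Matrix (Fin 2) (Fin 2) ℂ := fun i =>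
    Nat.rec (motive := fun i => (PBond (F.P Kt) 0 → Matrix (Fin 2) (Fin 2) ℂ) → PBond (F.P Kt) i → Matrix (Fin 2) (Fin 2) ℂ)
      (fun Y => Y) (fun _ q Y c => linAvg (q Y) c) i
  have hQ0 : ∀ Y, Q 0 Y = Y := fun Y => rfl
  have hQs : ∀ (i : ℕ) (Y : PBond (F.P Kt) 0 → Matrix (Fin 2) (Fin 2) ℂ) (c : PBond (F.P Kt) (i + 1)), Q (i + 1) Y c = linAvg (Q i Y) c :=
    fun i Y c => rfl
  -- ### the junction's seminorm `p := bond-ℓ²(HS)` and its letters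
  let p : Seminorm ℝ (PBond (F.P Kt) 0 → lieSU (Fin 2)) :=
    (normSeminorm ℝ (PiLp 2 (fun _ : PBond (F.P Kt) 0 => lieSU (Fin 2)))).comp (WithLp.linearEquiv 2 ℝ (PBond (F.P Kt) 0 → lieSU (Fin 2))).symm.toLinearMap
  have hp : ∀ Y : PBond (F.P Kt) 0 → lieSU (Fin 2), ∑ b, ‖(Y b : Matrix (Fin 2) (Fin 2) ℂ)‖ ^ 2 ≤ p Y ^ 2 := fun Y => sum_opNorm_sq_le_l2Seminorm_sq Y
  let n : ℝ := Real.sqrt (Fintype.card (PBond (F.P Kt) 0))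
  have hn0 : 0 ≤ n := Real.sqrt_nonneg _
  have hpsup : ∀ Y : PBond (F.P Kt) 0 → lieSU (Fin 2), p Y ≤ n * ‖Y‖ := fun Y => l2Seminorm_le_sqrt_card_mul_norm Y
  have hpl1 : ∀ Y : PBond (F.P Kt) 0 → lieSU (Fin 2), ∑ b, ‖(Y b : Matrix (Fin 2) (Fin 2) ℂ)‖ ≤ n * p Y := fun Y => sum_opNorm_le_sqrt_card_mul_l2Seminorm Y
  -- the `ℓ¹`-dominating seminorm of the current letter: `p₁ := √#bonds • p`
  let p₁ : Seminorm ℝ (PBond (F.P Kt) 0 → lieSU (Fin 2)) :=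
    p.comp (n • (LinearMap.id : (PBond (F.P Kt) 0 → lieSU (Fin 2)) →ₗ[ℝ] (PBond (F.P Kt) 0 → lieSU (Fin 2))))
  have hp₁_apply : ∀ Y : PBond (F.P Kt) 0 → lieSU (Fin 2), p₁ Y = n * p Y := fun Y => by
    show p ((n • (LinearMap.id : (PBond (F.P Kt) 0 → lieSU (Fin 2)) →ₗ[ℝ] (PBond (F.P Kt) 0 → lieSU (Fin 2)))) Y) = n * p Y
    rw [LinearMap.smul_apply, LinearMap.id_apply, map_smul_eq_mul, Real.norm_of_nonneg hn0]
  have hp₁ : ∀ Y : PBond (F.P Kt) 0 → lieSU (Fin 2), ∑ b, ‖(Y b : Matrix (Fin 2) (Fin 2) ℂ)‖ ≤ p₁ Y := fun Y => by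
    rw [hp₁_apply]; exact hpl1 Y
  -- ### the per-height ∕ per-instance constant packages, BY NAME
  -- (δ₂) at `𝐁_k(Z)` (module D through this seat's `exists_delta2_letter_Bj`) and its guard from near-flatness
  obtain ⟨C, ρD, hC, hρD, hD⟩ := exists_delta2_letter_Bj (F := F) (N := 2) (K := Kt) k ν.M₁ Z Q hQ0 hQs p hp
  obtain ⟨t₀, ρg, ht₀, hst, hρg, hguard⟩ := exists_guard_of_nearFlat (F := F) (N := 2) Kt k
  -- (μ) with one chart-curvature constant per height, and the `SmallBelow` guard from near-flatness
  obtain ⟨M₂, ρμ, hM₂, hρμ, hμ⟩ := exists_uniform_lam_mu_msChart (F := F) (N := 2) (K := Kt) k p hp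
  obtain ⟨M₂', ρb, -, hρb, hsbU, -⟩ := exists_uniform_chartCurvature_sq_bound (F := F) (N := 2) (K := Kt) k
  -- dag-n10-w1's flat right inverse at `𝐁_k(Z)` (J-C's `R_f`), with its operator norm as the letter in `p`-currency
  obtain ⟨Hf, B, hB0, hHf, hHfB⟩ := exists_rightInverse_fderiv_msChart_Bj_one (F := F) (N := 2) (K := Kt) (k := k) hM2 hk (Z := Z) hdiv
  let ρf : ℝ := n * Real.sqrt 2 * B
  have hρf0 : 0 ≤ ρf := by positivity
  have hρf : ∀ v, p (Hf v) ≤ ρf * ‖v‖ := fun v => by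
    have hterm : ∀ b, ‖Hf v b‖ ^ 2 ≤ 2 * (B * ‖v‖) ^ 2 := fun b => by
      have h1 := norm_sq_lieSU_le_card_mul_opNorm_sq (Hf v b)
      have h2 : ‖((Hf v b : lieSU (Fin 2)) : Matrix (Fin 2) (Fin 2) ℂ)‖ ≤ B * ‖v‖ :=
        (norm_le_pi_norm (fun b => ((Hf v b : lieSU (Fin 2)) : Matrix (Fin 2) (Fin 2) ℂ)) b).trans (hHfB v)
      have h3 := pow_le_pow_left₀ (norm_nonneg _) h2 2
      calc ‖Hf v b‖ ^ 2 ≤ ((2 : ℕ) : ℝ) * ‖((Hf v b : lieSU (Fin 2)) : Matrix (Fin 2) (Fin 2) ℂ)‖ ^ 2 := h1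
        _ ≤ 2 * (B * ‖v‖) ^ 2 := by rw [Nat.cast_ofNat]; exact mul_le_mul_of_nonneg_left h3 (by norm_num)
    have e : p (Hf v) = Real.sqrt (∑ b, ‖Hf v b‖ ^ 2) := l2Seminorm_apply _
    rw [e]
    calc Real.sqrt (∑ b, ‖Hf v b‖ ^ 2) ≤ Real.sqrt (∑ _b : PBond (F.P Kt) 0, 2 * (B * ‖v‖) ^ 2) :=
          Real.sqrt_le_sqrt (Finset.sum_le_sum fun b _ => hterm b)
      _ = Real.sqrt ((Fintype.card (PBond (F.P Kt) 0) : ℝ) * (Real.sqrt 2 * (B * ‖v‖)) ^ 2) := by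
          congr 1
          rw [Finset.sum_const, Finset.card_univ, nsmul_eq_mul, mul_pow (Real.sqrt 2) (B * ‖v‖) 2,
            Real.sq_sqrt (by norm_num : (0 : ℝ) ≤ 2)]
      _ = n * (Real.sqrt 2 * (B * ‖v‖)) := by rw [Real.sqrt_mul (Nat.cast_nonneg _), Real.sqrt_sq (by positivity)]
      _ = ρf * ‖v‖ := by simp only [ρf]; ring
  -- the averages stay close: `‖Ū^k(U) − 1‖ ≤ K_τ‖↑U − 1‖`
  obtain ⟨Kτ, ρτ, hKτ, hρτ, hτW⟩ := exists_norm_iterM_sub_one_le (P := F.P Kt) (N := 2) k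
  -- ### the constants
  refine ⟨min (min (ρD / 2) ρg) (min (min ρμ ρb) (min (ρτ / 2) (1 / (2 * (C * ρf + 1))))),
    32 * (((F.P Kt).d : ℝ) - 1) * n * ρf * M₂, ρf, C, 2 * (Kτ + 1),
    by positivity, ?_, hρf0, hC, by positivity, ?_⟩
  · have hd1 : (1 : ℝ) ≤ ((F.P Kt).d : ℝ) := by exact_mod_cast h0
    have : 0 ≤ ((F.P Kt).d : ℝ) - 1 := by linarith
    positivity
  intro ext Vk R 𝓐₀ hR h𝓐₀ δc δin hδc0 hδin0 hδpos hδρ U₀ Xf hmin0 hC1 hCin hX₀ hXc hmin hKb hsupp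
  -- ### radii
  let δ : ℝ := max δc δin
  have hδ0 : 0 ≤ δ := hδpos.le
  have hδD : δ < ρD := by
    have : δ ≤ ρD / 2 := hδρ.trans ((min_le_left _ _).trans (min_le_left _ _))
    linarith
  have hδg : δ ≤ ρg := hδρ.trans ((min_le_left _ _).trans (min_le_right _ _))
  have hδμ : δ ≤ ρμ := hδρ.trans ((min_le_right _ _).trans ((min_le_left _ _).trans (min_le_left _ _)))
  have hδb : δ ≤ ρb := hδρ.trans ((min_le_right _ _).trans ((min_le_left _ _).trans (min_le_right _ _)))
  have hδτ : δ < ρτ := by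
    have : δ ≤ ρτ / 2 := hδρ.trans ((min_le_right _ _).trans ((min_le_right _ _).trans (min_le_left _ _)))
    linarith
  have hδN : δ ≤ 1 / (2 * (C * ρf + 1)) := hδρ.trans ((min_le_right _ _).trans ((min_le_right _ _).trans (min_le_right _ _)))
  -- ### §1: `U₀` is GLOBALLY `δ`-near-flat
  have hUb : ∀ b : PBond (F.P Kt) 0, ‖((U₀ b : SU2) : Matrix (Fin 2) (Fin 2) ℂ) - 1‖ ≤ δ :=
    norm_sub_one_le_of_plaqNear_of_inputs (F := F) h2 hk0 ν.M₁ Z hC1 hCin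
  have hU' : ‖coeField U₀ - 1‖ ≤ δ := norm_coeField_sub_one_le hδ0 hUb
  -- ### the objects at the record
  have h𝔹 : ∀ j', k < j' → Bj ν.M₁ Z k j' = ∅ := fun _ hj' => Bj_of_gt hj'
  have hUfib : AgreeOn (Bj ν.M₁ Z k) (avgFamily (avOfRecord F 2 Kt) U₀) (avgFamily (avOfRecord F 2 Kt) (qsstarGIter0 k (ext Vk))) := hmin0.2.1
  have hsb : SmallBelow (avOfRecord F 2 Kt) k U₀ := hsbU U₀ (hU'.trans hδb)
  have hcrit : IsCritOnFibre F 2 Kt (Bj ν.M₁ Z k) (avgFamily (avOfRecord F 2 Kt) (qsstarGIter0 k (ext Vk))) U₀ :=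
    isCritOnFibre_of_isMinimizer_regMSCoPOfRecord ν (maxDomT ν.M₁ Z) hmin0
  have hgd : ∀ i, i < k → PlaqSmall t₀ (Averaging.iter (avOfRecord F 2 Kt) i U₀) := fun i hi => hguard U₀ (hU'.trans hδg) i hi.le
  -- ### (δ₂) in the junction's currency
  have hδ₂w : ∀ w, ‖fderiv ℝ (msChart F 2 Kt k (Bj ν.M₁ Z k) (avgFamily (avOfRecord F 2 Kt) (qsstarGIter0 k (ext Vk))) U₀) 0 w
      - fderiv ℝ (msChart F 2 Kt k (Bj ν.M₁ Z k) (avgFamily (avOfRecord F 2 Kt) (1 : GaugeField (F.P Kt) 0 SU2)) (1 : GaugeField (F.P Kt) 0 SU2)) 0 w‖ ≤ C * δ * p w := by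
    intro w
    refine (hD ht₀ hst U₀ (avgFamily (avOfRecord F 2 Kt) (qsstarGIter0 k (ext Vk))) hgd (lt_of_le_of_lt hU' hδD) hUfib w).trans ?_
    exact mul_le_mul_of_nonneg_right (mul_le_mul_of_nonneg_left hU' hC) (apply_nonneg p w)
  -- ### the Neumann right inverse of `DΨ(0)` (for `hlam` ∕ (μ)), with letter `2ρf`
  have hδ₂0 : 0 ≤ C * δ := by positivity
  have hhalf : C * δ * ρf ≤ 1 / 2 := by
    have hpos : 0 < 2 * (C * ρf + 1) := by positivity
    have h1 : δ * (2 * (C * ρf + 1)) ≤ 1 := by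
      calc δ * (2 * (C * ρf + 1)) ≤ 1 / (2 * (C * ρf + 1)) * (2 * (C * ρf + 1)) := mul_le_mul_of_nonneg_right hδN hpos.le
        _ = 1 := by field_simp
    have e : C * δ * ρf = (δ * (2 * (C * ρf + 1)) - 2 * δ) / 2 := by ring
    rw [e]
    linarith
  have hsmall : C * δ * ρf < 1 := by linarith
  obtain ⟨Rn, hRn, hρRn⟩ := exists_rightInverse_fun_of_flat_of_delta2 p
    ((fderiv ℝ (msChart F 2 Kt k (Bj ν.M₁ Z k) (avgFamily (avOfRecord F 2 Kt) (qsstarGIter0 k (ext Vk))) U₀) 0).toLinearMap)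
    ((fderiv ℝ (msChart F 2 Kt k (Bj ν.M₁ Z k) (avgFamily (avOfRecord F 2 Kt) (1 : GaugeField (F.P Kt) 0 SU2)) (1 : GaugeField (F.P Kt) 0 SU2)) 0).toLinearMap)
    Hf hHf hρf0 hδ₂0 hρf (fun w => hδ₂w w) hsmall
  have hρR2 : ∀ v, p (Rn v) ≤ 2 * ρf * ‖v‖ := fun v => by
    refine (hρRn v).trans (mul_le_mul_of_nonneg_right ?_ (norm_nonneg v))
    have h1 : 0 < 1 - C * δ * ρf := by linarith
    rw [div_le_iff₀ h1]
    have h2 : 0 ≤ ρf * (1 - 2 * (C * δ * ρf)) := mul_nonneg hρf0 (by linarith)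
    calc ρf = 2 * ρf * (1 - C * δ * ρf) - ρf * (1 - 2 * (C * δ * ρf)) := by ring
      _ ≤ 2 * ρf * (1 - C * δ * ρf) := sub_le_self _ h2
  -- ### the global current letter `j = 8(d−1)·δ·√#bonds`
  have hj : ∀ x, |fderiv ℝ (fun Y : PBond (F.P Kt) 0 → lieSU (Fin 2) => wilsonAction4 (expChart U₀ Y)) 0 x| ≤ (8 * (((F.P Kt).d : ℝ) - 1) * δ * n) * p x := by
    intro x
    have h := letter_j_wilson_local U₀ (Set.univ : Set (PBond (F.P Kt) 0)) hδ0
      (fun q _ => ⟨hUb _, hUb _, hUb _, hUb _⟩) p₁ hp₁ x (fun b hb => absurd (Set.mem_univ b) hb)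
    rw [hp₁_apply x] at h
    linarith
  have hd1 : 0 ≤ ((F.P Kt).d : ℝ) - 1 := by
    have : (1 : ℝ) ≤ ((F.P Kt).d : ℝ) := by exact_mod_cast h0
    linarith
  have hj0 : 0 ≤ 8 * (((F.P Kt).d : ℝ) - 1) * δ * n := by positivity
  -- ### the multiplier with (μ)
  obtain ⟨lam, hlam, hμw⟩ := hμ (Bj ν.M₁ Z k) (avgFamily (avOfRecord F 2 Kt) (qsstarGIter0 k (ext Vk))) U₀ h𝔹 (hU'.trans hδμ) hUfib hcrit
    Rn (fun v => hRn v) (8 * (((F.P Kt).d : ℝ) - 1) * δ * n) (2 * ρf) hj0 (by positivity) hj hρR2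
  -- ### the chart's regularity binders
  have hΨ₂ := hasFDerivAt_fderiv_msChart hUfib hsb
  have hΨd := eventually_differentiableAt_msChart hUfib hsb
  have hΨ : DifferentiableAt ℝ (msChart F 2 Kt k (Bj ν.M₁ Z k) (avgFamily (avOfRecord F 2 Kt) (qsstarGIter0 k (ext Vk))) U₀) 0 :=
    differentiableAt_msChart hUfib hsb
  -- ### the twist size: the datum's top constrained averages are `Ū^k(U₀)`, within `K_τ·δ` of `1`
  have hiter : ‖(iterM k : (PBond (F.P Kt) 0 → Matrix (Fin 2) (Fin 2) ℂ) → PBond (F.P Kt) k → Matrix (Fin 2) (Fin 2) ℂ) (coeField U₀) - 1‖ ≤ Kτ * δ :=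
    (hτW U₀ (lt_of_le_of_lt hU' hδτ)).trans (mul_le_mul_of_nonneg_left hU' hKτ)
  have hcoe : coeField (Averaging.iter (avOfRecord F 2 Kt) k U₀) = iterM k (coeField U₀) := coeField_iter_eq_iterM k hsb
  have hW : ∀ c ∈ bondsOf (Bj ν.M₁ Z k k),
      ‖((avgFamily (avOfRecord F 2 Kt) (qsstarGIter0 k (ext Vk)) k c : SU 2) : Matrix (Fin 2) (Fin 2) ℂ) - 1‖ ≤ (2 * (Kτ + 1) * δ) / 2 := by
    intro c hc
    rw [← hUfib k c hc]
    have e : ((avgFamily (avOfRecord F 2 Kt) U₀ k c : SU 2) : Matrix (Fin 2) (Fin 2) ℂ) - 1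
        = ((iterM k : (PBond (F.P Kt) 0 → Matrix (Fin 2) (Fin 2) ℂ) → PBond (F.P Kt) k → Matrix (Fin 2) (Fin 2) ℂ) (coeField U₀) - 1) c := by
      rw [Pi.sub_apply, ← hcoe, coeField_apply, Pi.one_apply]; rfl
    rw [e]
    refine (norm_le_pi_norm _ c).trans (hiter.trans ?_)
    nlinarith
  have hτ : 0 < 2 * (Kτ + 1) * δ := by positivity
  have hX1 := (hXc.differentiableAt two_ne_zero).hasFDerivAt
  have hN2 : ((2 : ℕ) : ℝ) = 2 := Nat.cast_ofNat
  -- ### assemble the tail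
  refine ⟨fderiv ℝ (fderiv ℝ (msChart F 2 Kt k (Bj ν.M₁ Z k) (avgFamily (avOfRecord F 2 Kt) (qsstarGIter0 k (ext Vk))) U₀)) 0, lam, p, fun v => ‖v‖,
    fderiv ℝ (msChart F 2 Kt k (Bj ν.M₁ Z k) (avgFamily (avOfRecord F 2 Kt) (1 : GaugeField (F.P Kt) 0 SU2)) (1 : GaugeField (F.P Kt) 0 SU2)) 0,
    fun v => Hf v, hΨ₂, hΨd, hlam, hp, hHf, hρf, fun X => ⟨hδ₂w _, ?_, ?_, ?_⟩⟩
  · -- (μ)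
    have h := hμw (fderiv ℝ Xf 0 X)
    rw [hN2] at h
    refine h.trans (le_of_eq ?_)
    ring
  · -- (K) from the per-bond velocity bound and the support letter
    have ha : 0 ≤ 12 * 𝓐₀ / R * ‖X‖ := by positivity
    have h := l2Seminorm_le_of_bound_of_support (N := 2) (maxDomT ν.M₁ Z 1) (fderiv ℝ Xf 0 X) ha (fun b => (hKb X b).2) (fun b hb => hsupp X b hb)
    calc p (fderiv ℝ Xf 0 X) ≤ Real.sqrt (Nat.card {b : PBond (F.P Kt) 0 // b.src ∈ maxDomT ν.M₁ Z 1}) * (12 * 𝓐₀ / R * ‖X‖) := h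
      _ = (12 * 𝓐₀ / R * Real.sqrt (Nat.card {b : PBond (F.P Kt) 0 // b.src ∈ maxDomT ν.M₁ Z 1})) * ‖X‖ := by ring
  · -- the Federbush clause at the curved chart, through the twist (Pauli coordinates of `𝔰𝔲(2)` by dag-n12-w3's `exists_lieSU2Coord`, eliminated in term mode:
    -- an `obtain` on it makes later elaboration of `GaugeSlice … E3`-typed terms time out at `whnf` in this context)
    exact exists_lieSU2Coord.elim fun φ hφ =>
      exists_m_hm_twisted_window_of_isMinimizer_family h0 hk Z X (fun κ => lo κ - 2) hbox hφ hΩw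
        (regMSCoPOfRecord F 2 ν Kt k (maxDomT ν.M₁ Z)) (ext Vk) U₀ hX₀ hmin hX1 hΨ hτ hW

end Main

end Summit.QuantumFields.YangMills.BalabanUVNodes.N12NearFlatChartLetter

end
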